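import Mathlib
import Literature.MathematicalPhysics.QuantumFieldTheory.Balaban1983to89.Beta.VectorTailsSeam
import Literature.MathematicalPhysics.QuantumFieldTheory.Balaban1983to89.Beta.BlockKernelVolumeSockets

/-!
# The vector legs in the EVEN CUBIC VOLUME — the `Γ`-rows and volume-limit adapter (β sub-cell, row an5)

HONEST FRAMING (verbatim, p. 1 of everything in this cell): discharging `BetaPertH` makes
Bałaban's UV stability UNCONDITIONAL — a real constructive-QFT result; it is NOT the continuum
limit and NOT the Clay problem.  ABSOLUTE RULE: no internally-minted statement enters as a cited
fact; every hypothesis below is either kernel-proved in this package or a NAMED binder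
(`B5.Prop12Printed`, `B5.Kernel126_127Printed` — the printed Prop. 1.2 / (1.126)–(1.127) shapes,
passed BY NAME and never discharged here).  All tags `[folklore]`; zero cited facts; no `sorry`.
The two citations in the docstrings are CONTEXT ONLY (where the objects come from), never used as
hypotheses: [Balaban1984PropagatorsI, (1.83) p. 31] (the block-averaged propagator `Δ_a⁻¹`),
[Balaban1987RG1, p. 251, p. 264] (cubic tori; the `t → ∞` volume limit at fixed scale).

WHAT IS PROVED (bookkeeping only — every estimate used is already kernel in the tree).  The an1
seam `Beta/VectorTailsSeam.endpointExistence_of_vectorTails_uniformBlock` composes the vector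
small-field legs with the scalar wall for ANY volume family `Mv`, leaving as binders (besides the
printed Props and the wall's one-loop data): the growth of the volumes `hgrow`, the `Γ`-part
free-comparison rows `h0S / h1S / h1×S / h2×S` with constants `D`, and the pointwise volume limits
`hG / hg`.  This file DISCHARGES those six binders for the EVEN CUBIC VOLUME FAMILY
`MvE (n, t) = cubic 4 (2(t+1))` (fine torus `(ℤ/(n·2(t+1)))⁴`, `t → ∞` along `atTop`), with the
real reading `φ = re` and DIAGONAL components `kk = nn = k` (forced: the `Γ`-part is diagonal in
the components, `VectorTailsWindow.rdS_eq_zero_of_ne`, while the free leg is not `0`):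
* §1 identifies the diagonal `Γ`-reading on an equal-period torus with the an5 free leg minus
  `N²·Re R^⊥_w` (`WoodburyCovariant.RperpW` for the bond-averaging weight `wt (bondAvg κ)`):
  `rdS(x₀; κ, κ; v) = torusFreeLeg N m a (−v) − N² Re R^⊥_w(x₀ + v, x₀)` (`rdS_diag_eq`);
* §2 derives the four free-comparison rows PER TORUS, uniformly in the volume, from the four
  volume-uniform Woodbury bounds `norm_RperpW_le / norm_dRperpW_le / norm_dRperpW'_le /
  norm_ddRperpW_le` (constants `woodburyDc 0 / N²`, `woodburyD1c 0 / N³`, `2·woodburyD1c 0 / N³`,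
  `woodburyD2c 0 / N⁴`), the cross rows after removing the block translation of the wrapped shift
  (`VectorTailsWindow.rdS_translate`);
* §3 instantiates: `MvE`, its growth `hgrowE`, the comparison leg `gE := torusFreeLeg (−v)`, the
  constants `DE`, and the four rows in the seam's binder shape (`h0S_E … h2xS_E`, eventually-in-`t`
  because they hold for every `t`);
* §4 proves the volume limits: `hg` is the free-leg socket (`BlockKernelVolumeSockets.freeLeg_socket`,
  `G₀(−v) = gFree v`), and `hg`'s partner `hG` follows from the split `rd = rdS + rdL`
  (`VectorTailsWindow.rd_eq_rdS_add_rdL`), §1, and the two kernel sockets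
  `RperpB_socket_re / Lker_socket_re` after moving both sites into `emb`-representatives by a block
  translation (`VectorTailsPt.rd_translate`); the limit `GfE` is EXPLICIT:
  `gFree v − n² Re RperpBLim(…) + n² Re LkerLim(…)`;
* §5 is the END-TO-END composition `endpointExistence_of_vectorTails_evenVolume`:
  `EndpointExistence Cn` MODULO exactly {the printed Props h12 / h126 BY NAME for the family
  `(n,t) ↦ (n, MvE (n,t))`, the wall's one-loop data (hgen, S, hμν, hN, hL, hc/hM/hML, hU — now
  about the explicit `GfE` —, hid, hγ₀, hrem, hr, hβ', hcont, hup)}.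

WHAT IS NOT CLAIMED.  Not `BetaPertH` nor any discharge of it (forbidden deliverables, rulings
(R6), (R15-2)(d)); not the printed Props; not the massless zero-fibre bookkeeping (γ) of BETA-SPEC §7.23
(the free leg `torusFreeLeg` carries the zero-mode constant `N²/(a|𝕋|) → 0` explicitly, as in
`Beta/FreeLegDictionary`); NOT summit progress.
-/

noncomputable section

open Filter Topology
open scoped BigOperators

namespace Literature.MathematicalPhysics.QuantumFieldTheory.Balaban1983to89.Beta.VectorLegVolumeAdapter

open Literature.MathematicalPhysics.QuantumFieldTheory.Balaban1983to89
open Literature.MathematicalPhysics.QuantumFieldTheory.Balaban1983to89.Beta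
open Literature.MathematicalPhysics.QuantumFieldTheory.Balaban1983to89.B5Prop11Plancherel
  (Tor fine unitVec)
open Literature.MathematicalPhysics.QuantumFieldTheory.Balaban1983to89.Beta.DyadicShell (Pt)
open Literature.MathematicalPhysics.QuantumFieldTheory.Balaban1983to89.Beta.GhostTable (gFree)
open Literature.MathematicalPhysics.QuantumFieldTheory.Balaban1983to89.Beta.PoissonInterior (G₀)
open Literature.MathematicalPhysics.QuantumFieldTheory.Balaban1983to89.Beta.VectorTails
  (castT castT_add castT_neg)
open Literature.MathematicalPhysics.QuantumFieldTheory.Balaban1983to89.Beta.WoodburyFibre (GfreePerp cM)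
open Literature.MathematicalPhysics.QuantumFieldTheory.Balaban1983to89.Beta.WoodburyCovariant
  (wt bondAvg RperpW dRperpW dRperpW' ddRperpW admissible_bondAvg norm_RperpW_le norm_dRperpW_le
    norm_dRperpW'_le norm_ddRperpW_le woodburyDc woodburyD1c woodburyD2c mixedEc_nonneg
    doubleEc_nonneg)
open Literature.MathematicalPhysics.QuantumFieldTheory.Balaban1983to89.Beta.FreeLegDictionary
  (cubic torusFreeLeg)
open Literature.MathematicalPhysics.QuantumFieldTheory.Balaban1983to89.Beta.BlockKernelVolumeSockets
  (evenPeriod tendsto_evenPeriod freeLeg_socket RperpB_socket_re Lker_socket_re RperpBLim_blockShift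
    LkerLim_blockShift)
open Literature.MathematicalPhysics.QuantumFieldTheory.Balaban1983to89.Beta.VectorPropagatorDict
  (gammaSum gammaSum_apply)
open Literature.MathematicalPhysics.QuantumFieldTheory.Balaban1983to89.Beta.LongitudinalWindow (Lker)
open Literature.MathematicalPhysics.QuantumFieldTheory.Balaban1983to89.Beta.LongitudinalSymbol (LkerLim)
open Literature.MathematicalPhysics.QuantumFieldTheory.Balaban1983to89.Beta.WoodburyBondSymbol
  (RperpBLim)
open Literature.MathematicalPhysics.QuantumFieldTheory.Balaban1983to89.Beta.VectorTailsLoc (fam kfam)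
open Literature.MathematicalPhysics.QuantumFieldTheory.Balaban1983to89.Beta.VectorTailsPt
  (rd GT GT_pos rd_translate blockSteps castT_blockVec_mem_blockSteps castT_add_unitVec abs_re_le)
open Literature.MathematicalPhysics.QuantumFieldTheory.Balaban1983to89.Beta.VectorTailsWindow
  (rdS rdL rdS_eq rdL_eq rd_eq_rdS_add_rdL rdS_translate sq_mul_le_of GS)
open Literature.MathematicalPhysics.QuantumFieldTheory.Balaban1983to89.Beta.VectorTailsWindow (GS_pos)
open Literature.MathematicalPhysics.QuantumFieldTheory.Balaban1983to89.Beta.VectorTailsBlock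
  (lblock lshift X₀L lwrapped_hX)
open Literature.MathematicalPhysics.QuantumFieldTheory.Balaban1983to89.Beta.VectorTailsSeam
  (uwt endpointExistence_of_vectorTails_uniformBlock)
open FlowStep DagBinding
open Literature.MathematicalPhysics.QuantumFieldTheory.Balaban1983to89.Beta.MarginalTelescoping
  (composedCoeff IdentityForm)
open Literature.MathematicalPhysics.QuantumFieldTheory.Balaban1983to89.Beta.RemainderChain
  (RemainderConst)
open Literature.MathematicalPhysics.QuantumFieldTheory.Balaban1983to89.Beta.WindowIdentification
  (fullSum)
open Literature.MathematicalPhysics.QuantumFieldTheory.Balaban1983to89.Beta.SquareTable (stK)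

/-- the real reading `re : ℂ →+ ℝ` applied. [folklore] -/
theorem re_apply (z : ℂ) : Complex.reAddGroupHom z = z.re := rfl

/-! ## §0 Two bookkeeping identities on an equal-period torus `(ℤ/(N m))^d` -/

section Torus

variable {d : ℕ} (N m : ℕ)

/-- an `ℕ`-representative read through `castT` is `WoodburySymbol.emb`. [folklore] -/
theorem castT_natCast_eq_emb (x : Fin d → ℕ) :
    castT (fine N (cubic d m)) (fun i => ((x i : ℕ) : ℤ)) = WoodburySymbol.emb N m x := by
  funext i
  simp [castT, WoodburySymbol.emb]

/-- `castT` on the equal-period torus is the residue map `Torus.proj (N m)`. [folklore] -/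
theorem castT_eq_proj (z : Fin d → ℤ) :
    castT (fine N (cubic d m)) z =
      (Literature.Probability.LatticeModels.Torus.proj (N * m) z : Tor (fine N (cubic d m))) := rfl

end Torus

/-! ## §1 The diagonal `Γ`-reading = free leg − `N² Re R^⊥_w` -/

section Gamma

variable (N m : ℕ) [NeZero N] [NeZero m] (a : ℝ)

/-- the bond-averaging weight of component `κ` on the equal-period torus (`wt (bondAvg κ)` of
`Beta/WoodburyCovariant`). [folklore] -/
abbrev wB (κ : Fin 4) : Tor (fine N (cubic 4 m)) → ℂ :=
  wt N (cubic 4 m) (bondAvg N (cubic 4 m) κ)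

/-- **KEY IDENTITY.**  The diagonal `Γ`-part reading (real part) on the torus `(ℤ/(N m))⁴` is the
an5 free leg at `−v` minus `N²·Re R^⊥_w(x₀ + v, x₀)`:
`rdS N (cubic 4 m) a x₀ κ κ re v = torusFreeLeg N m a (−v) − N² Re RperpW(wB κ)(x₀ + castT v, x₀)`
(`gammaSum_apply` at `μ = ν = κ`; `x₀ − (x₀ + v) = −v`; the constant `N² Re(|𝕋|⁻¹ a⁻¹) = N²/(a|𝕋|)`
is the free leg's zero-mode term).  Context: [Balaban1984PropagatorsI, (1.83) p. 31]. [folklore] -/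
theorem rdS_diag_eq (x₀ : Tor (fine N (cubic 4 m))) (κ : Fin 4) (v : Pt) :
    rdS N (cubic 4 m) a x₀ κ κ Complex.reAddGroupHom v
      = torusFreeLeg N m a (-v)
        - ((N : ℕ) : ℝ) ^ 2 *
          (RperpW N (cubic 4 m) (wB N m κ) a 0 (x₀ + castT (fine N (cubic 4 m)) v) x₀).re := by
  rw [rdS_eq, gammaSum_apply, if_pos rfl]
  have e1 : x₀ - (x₀ + castT (fine N (cubic 4 m)) v)
      = (Literature.Probability.LatticeModels.Torus.proj (N * m) (-v) : Tor (fine N (cubic 4 m))) := by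
    rw [← castT_eq_proj, castT_neg]; abel
  rw [e1]
  have hG : ∀ G : ℂ, (((N : ℂ)) ^ 2 * G).re = ((N : ℕ) : ℝ) ^ 2 * G.re := by
    intro G
    rw [← Complex.ofReal_natCast, ← Complex.ofReal_pow, Complex.re_ofReal_mul]
  have hC : (((Fintype.card (Tor (fine N (cubic 4 m))) : ℂ))⁻¹ * (1 / (a : ℂ))).re
      = ((Fintype.card (Tor (fine N (cubic 4 m))) : ℝ))⁻¹ * (1 / a) := by
    rw [← Complex.ofReal_natCast, ← Complex.ofReal_inv, ← Complex.ofReal_one, ← Complex.ofReal_div,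
      ← Complex.ofReal_mul, Complex.ofReal_re]
  simp only [re_apply, Complex.sub_re, Complex.add_re, torusFreeLeg, hG, hC]
  ring

end Gamma

/-! ## §2 The four free-comparison rows PER TORUS, uniformly in the volume -/

section Rows

/-- `|N² Re z| ≤ N² ‖z‖`. [folklore] -/
theorem abs_sq_mul_re_le (N : ℕ) (z : ℂ) : |((N : ℕ) : ℝ) ^ 2 * z.re| ≤ ((N : ℕ) : ℝ) ^ 2 * ‖z‖ := by
  rw [abs_mul, abs_of_nonneg (by positivity : (0 : ℝ) ≤ ((N : ℕ) : ℝ) ^ 2)]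
  exact mul_le_mul_of_nonneg_left (Complex.abs_re_le_norm z) (by positivity)

variable (N m : ℕ) [NeZero N] [NeZero m] (hN : 1 ≤ N) (a : ℝ) (ha : 0 < a)
include hN ha

/-- **(Γ0) THE `Γ`-PART IS THE FREE LEG UP TO `N⁻²`**, uniformly in the volume `m`:
`|rdS(x₀; κ, κ; v) − torusFreeLeg N m a (−v)| ≤ woodburyDc 0 / N²` (`norm_RperpW_le` × `N²`).
[folklore] -/
theorem gamma_row0 (x₀ : Tor (fine N (cubic 4 m))) (κ : Fin 4) (v : Pt) :
    |rdS N (cubic 4 m) a x₀ κ κ Complex.reAddGroupHom v - torusFreeLeg N m a (-v)|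
      ≤ woodburyDc 0 / ((N : ℕ) : ℝ) ^ 2 := by
  rw [rdS_diag_eq, sub_sub_cancel_left, abs_neg]
  have h := norm_RperpW_le N m (admissible_bondAvg N (cubic 4 m) hN κ) hN ha le_rfl
    (x₀ + castT (fine N (cubic 4 m)) v) x₀
  exact (abs_sq_mul_re_le N _).trans (sq_mul_le_of N hN 4 2 rfl h)

/-- **(Γ1) ONE DIFFERENCE IN `v` GAINS `N⁻¹`**, uniformly in the volume:
`|(rdS(v + e_ρ) − tFL(−(v+e_ρ))) − (rdS(v) − tFL(−v))| ≤ woodburyD1c 0 / N³` (`norm_dRperpW_le` × `N²`).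
[folklore] -/
theorem gamma_row1 (x₀ : Tor (fine N (cubic 4 m))) (κ : Fin 4) (v : Pt) (ρ : Fin 4) :
    |(rdS N (cubic 4 m) a x₀ κ κ Complex.reAddGroupHom (v + BubbleTransfer.unitVec ρ)
          - torusFreeLeg N m a (-(v + BubbleTransfer.unitVec ρ)))
        - (rdS N (cubic 4 m) a x₀ κ κ Complex.reAddGroupHom v - torusFreeLeg N m a (-v))|
      ≤ woodburyD1c 0 / ((N : ℕ) : ℝ) ^ 3 := by
  rw [rdS_diag_eq, rdS_diag_eq, sub_sub_cancel_left, sub_sub_cancel_left, castT_add_unitVec,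
    ← add_assoc]
  have key :
      -(((N : ℕ) : ℝ) ^ 2 *
          (RperpW N (cubic 4 m) (wB N m κ) a 0
            (x₀ + castT (fine N (cubic 4 m)) v + unitVec (fine N (cubic 4 m)) ρ) x₀).re)
        - -(((N : ℕ) : ℝ) ^ 2 *
          (RperpW N (cubic 4 m) (wB N m κ) a 0 (x₀ + castT (fine N (cubic 4 m)) v) x₀).re)
      = -(((N : ℕ) : ℝ) ^ 2 *
          (dRperpW N (cubic 4 m) (wB N m κ) a 0 ρ (x₀ + castT (fine N (cubic 4 m)) v) x₀).re) := by
    simp only [dRperpW, Complex.sub_re]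
    ring
  rw [key, abs_neg]
  have h := norm_dRperpW_le N m (admissible_bondAvg N (cubic 4 m) hN κ) hN ha le_rfl ρ
    (x₀ + castT (fine N (cubic 4 m)) v) x₀
  exact (abs_sq_mul_re_le N _).trans (sq_mul_le_of N hN (4 + 1) 3 rfl h)

/-- **(Γ1×) THE CROSS-BASE-POINT DIFFERENCE GAINS `N⁻¹`**, uniformly in the volume: if the second
base point is the first translated by `e_μ` MODULO A BLOCK TRANSLATION, then
`|rdS(x₀′; v) − rdS(x₀; v)| ≤ 2·woodburyD1c 0 / N³` (`rdS_translate`; `norm_dRperpW_le` +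
`norm_dRperpW'_le`, × `N²`). [folklore] -/
theorem gamma_row1x {x₀ x₀' : Tor (fine N (cubic 4 m))} {μ : Fin 4}
    (hx : x₀' - (x₀ + unitVec (fine N (cubic 4 m)) μ) ∈ blockSteps N (cubic 4 m)) (κ : Fin 4)
    (v : Pt) :
    |rdS N (cubic 4 m) a x₀' κ κ Complex.reAddGroupHom v
        - rdS N (cubic 4 m) a x₀ κ κ Complex.reAddGroupHom v|
      ≤ 2 * woodburyD1c 0 / ((N : ℕ) : ℝ) ^ 3 := by
  have hx' : x₀' = x₀ + unitVec (fine N (cubic 4 m)) μ + (x₀' - (x₀ + unitVec (fine N (cubic 4 m)) μ)) := by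
    abel
  rw [hx', rdS_translate N hN (cubic 4 m) a ha hx, rdS_diag_eq, rdS_diag_eq]
  set y : Tor (fine N (cubic 4 m)) := x₀ + castT (fine N (cubic 4 m)) v with hy
  have e1 : x₀ + unitVec (fine N (cubic 4 m)) μ + castT (fine N (cubic 4 m)) v
      = y + unitVec (fine N (cubic 4 m)) μ := by
    rw [hy]; abel
  rw [e1]
  have key :
      torusFreeLeg N m a (-v)
          - ((N : ℕ) : ℝ) ^ 2 *
            (RperpW N (cubic 4 m) (wB N m κ) a 0 (y + unitVec (fine N (cubic 4 m)) μ)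
              (x₀ + unitVec (fine N (cubic 4 m)) μ)).re
        - (torusFreeLeg N m a (-v)
          - ((N : ℕ) : ℝ) ^ 2 * (RperpW N (cubic 4 m) (wB N m κ) a 0 y x₀).re)
      = -(((N : ℕ) : ℝ) ^ 2 *
          (dRperpW N (cubic 4 m) (wB N m κ) a 0 μ y (x₀ + unitVec (fine N (cubic 4 m)) μ)
            + dRperpW' N (cubic 4 m) (wB N m κ) a 0 μ y x₀).re) := by
    simp only [dRperpW, dRperpW', Complex.add_re, Complex.sub_re]
    ring
  rw [key, abs_neg]
  have hA := norm_dRperpW_le N m (admissible_bondAvg N (cubic 4 m) hN κ) hN ha le_rfl μ y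
    (x₀ + unitVec (fine N (cubic 4 m)) μ)
  have hB := norm_dRperpW'_le N m (admissible_bondAvg N (cubic 4 m) hN κ) hN ha le_rfl μ y x₀
  have hsum :
      ‖dRperpW N (cubic 4 m) (wB N m κ) a 0 μ y (x₀ + unitVec (fine N (cubic 4 m)) μ)
          + dRperpW' N (cubic 4 m) (wB N m κ) a 0 μ y x₀‖
        ≤ 2 * woodburyD1c 0 / ((N : ℕ) : ℝ) ^ (4 + 1) := by
    rw [two_mul, add_div]
    exact (norm_add_le _ _).trans (add_le_add hA hB)
  exact (abs_sq_mul_re_le N _).trans (sq_mul_le_of N hN (4 + 1) 3 rfl hsum)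

/-- **(Γ2×) THE CROSS MIXED SECOND DIFFERENCE GAINS `N⁻²`**, uniformly in the volume: with
`x₀′ ≡ x₀ + e_μ` modulo a block translation,
`|(rdS(x₀; v+e_μ+e_ν) − tFL) − (rdS(x₀; v+e_μ) − tFL) − ((rdS(x₀′; v+e_ν) − tFL) − (rdS(x₀′; v) − tFL))|
≤ woodburyD2c 0 / N⁴` (`rdS_translate`; `norm_ddRperpW_le` × `N²`). [folklore] -/
theorem gamma_row2x {x₀ x₀' : Tor (fine N (cubic 4 m))} {μ : Fin 4}
    (hx : x₀' - (x₀ + unitVec (fine N (cubic 4 m)) μ) ∈ blockSteps N (cubic 4 m)) (ν κ : Fin 4)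
    (v : Pt) :
    |(rdS N (cubic 4 m) a x₀ κ κ Complex.reAddGroupHom
            (v + BubbleTransfer.unitVec μ + BubbleTransfer.unitVec ν)
          - torusFreeLeg N m a (-(v + BubbleTransfer.unitVec μ + BubbleTransfer.unitVec ν)))
        - (rdS N (cubic 4 m) a x₀ κ κ Complex.reAddGroupHom (v + BubbleTransfer.unitVec μ)
          - torusFreeLeg N m a (-(v + BubbleTransfer.unitVec μ)))
        - ((rdS N (cubic 4 m) a x₀' κ κ Complex.reAddGroupHom (v + BubbleTransfer.unitVec ν)
            - torusFreeLeg N m a (-(v + BubbleTransfer.unitVec ν)))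
          - (rdS N (cubic 4 m) a x₀' κ κ Complex.reAddGroupHom v - torusFreeLeg N m a (-v)))|
      ≤ woodburyD2c 0 / ((N : ℕ) : ℝ) ^ 4 := by
  have hx' : x₀' = x₀ + unitVec (fine N (cubic 4 m)) μ + (x₀' - (x₀ + unitVec (fine N (cubic 4 m)) μ)) := by
    abel
  rw [hx', rdS_translate N hN (cubic 4 m) a ha hx, rdS_translate N hN (cubic 4 m) a ha hx]
  simp only [rdS_diag_eq, sub_sub_cancel_left, castT_add_unitVec]
  set y : Tor (fine N (cubic 4 m)) :=
    x₀ + castT (fine N (cubic 4 m)) v + unitVec (fine N (cubic 4 m)) μ with hy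
  have e1 : x₀ + (castT (fine N (cubic 4 m)) v + unitVec (fine N (cubic 4 m)) μ
        + unitVec (fine N (cubic 4 m)) ν) = y + unitVec (fine N (cubic 4 m)) ν := by
    rw [hy]; abel
  have e2 : x₀ + (castT (fine N (cubic 4 m)) v + unitVec (fine N (cubic 4 m)) μ) = y := by
    rw [hy]; abel
  have e3 : x₀ + unitVec (fine N (cubic 4 m)) μ
        + (castT (fine N (cubic 4 m)) v + unitVec (fine N (cubic 4 m)) ν)
      = y + unitVec (fine N (cubic 4 m)) ν := by
    rw [hy]; abel
  have e4 : x₀ + unitVec (fine N (cubic 4 m)) μ + castT (fine N (cubic 4 m)) v = y := by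
    rw [hy]; abel
  rw [e1, e2, e3, e4]
  have key :
      -(((N : ℕ) : ℝ) ^ 2 *
          (RperpW N (cubic 4 m) (wB N m κ) a 0 (y + unitVec (fine N (cubic 4 m)) ν) x₀).re)
        - -(((N : ℕ) : ℝ) ^ 2 * (RperpW N (cubic 4 m) (wB N m κ) a 0 y x₀).re)
        - (-(((N : ℕ) : ℝ) ^ 2 *
            (RperpW N (cubic 4 m) (wB N m κ) a 0 (y + unitVec (fine N (cubic 4 m)) ν)
              (x₀ + unitVec (fine N (cubic 4 m)) μ)).re)
          - -(((N : ℕ) : ℝ) ^ 2 *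
            (RperpW N (cubic 4 m) (wB N m κ) a 0 y (x₀ + unitVec (fine N (cubic 4 m)) μ)).re))
      = ((N : ℕ) : ℝ) ^ 2 * (ddRperpW N (cubic 4 m) (wB N m κ) a 0 ν μ y x₀).re := by
    simp only [ddRperpW, Complex.add_re, Complex.sub_re]
    ring
  rw [key]
  have h := norm_ddRperpW_le N m (admissible_bondAvg N (cubic 4 m) hN κ) hN ha le_rfl ν μ y x₀
  exact (abs_sq_mul_re_le N _).trans (sq_mul_le_of N hN (4 + 2) 4 rfl h)

end Rows

/-! ## §3 The even cubic volume instance: `MvE`, `hgrowE`, `gE`, `DE`, the four rows in binder shape -/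

section Instance

/-- THE EVEN CUBIC VOLUME FAMILY: at scale `n` and volume index `t` every coarse period is
`2(t+1)` (fine torus `(ℤ/(n·2(t+1)))⁴`).  Context: [Balaban1987RG1, p. 251] (cubic tori).
[folklore] -/
abbrev MvE : ℕ+ × ℕ → Fin 4 → ℕ := fun i => cubic 4 (evenPeriod i.2)

/-- the periods of `MvE` are nonzero (instance). [folklore] -/
instance instNeZeroMvE (i : ℕ+ × ℕ) (ρ : Fin 4) : NeZero (MvE i ρ) :=
  BlockKernelVolumeSockets.neZero_evenPeriod i.2

/-- **the growth binder `hgrow` HOLDS for `MvE`**: `n · 2(t+1) → ∞` as `t → ∞`. [folklore] -/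
theorem hgrowE : ∀ (m : ℕ+) (ρ : Fin 4), Tendsto (fun t => (m : ℕ) * MvE (m, t) ρ) atTop atTop :=
  fun m _ => tendsto_atTop_mono (fun t => Nat.le_mul_of_pos_left (evenPeriod t) m.pos)
    tendsto_evenPeriod

variable {L : Type*}

/-- THE COMPARISON LEG `gT` of the instance: the an5 free leg of the torus of scale `n` and
volume `t`, read at `−v` (independent of the base point), `0` at the unused scale `n = 0`.
[folklore] -/
def gE (a : ℝ) (n : ℕ) (_b : Pt × L) (t : ℕ) (v : Pt) : ℝ :=
  if h : 0 < n then torusFreeLeg (PNat.val ⟨n, h⟩) (evenPeriod t) a (-v) else 0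

/-- `gE` at a positive scale. [folklore] -/
theorem gE_pos (a : ℝ) {n : ℕ} (h : 0 < n) (b : Pt × L) (t : ℕ) (v : Pt) :
    gE a n b t v = torusFreeLeg (PNat.val ⟨n, h⟩) (evenPeriod t) a (-v) := dif_pos h

/-- THE CONSTANTS of the four `Γ`-rows: `DE 0 = woodburyDc 0`, `DE 1 = woodburyD1c 0`,
`DE 2 = woodburyD2c 0`, `DE 3 = 2·woodburyD1c 0` (and the last value at unused indices).
[folklore] -/
def DE : ℕ → ℝ
  | 0 => woodburyDc 0
  | 1 => woodburyD1c 0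
  | 2 => woodburyD2c 0
  | _ => 2 * woodburyD1c 0

/-- [folklore] -/ theorem DE_zero : DE 0 = woodburyDc 0 := rfl
/-- [folklore] -/ theorem DE_one : DE 1 = woodburyD1c 0 := rfl
/-- [folklore] -/ theorem DE_two : DE 2 = woodburyD2c 0 := rfl
/-- [folklore] -/ theorem DE_three : DE 3 = 2 * woodburyD1c 0 := rfl

/-- `woodburyDc 0 ≥ 0`. [folklore] -/
theorem woodburyDc_zero_nonneg : 0 ≤ woodburyDc 0 := by unfold woodburyDc; positivity

/-- `woodburyD1c 0 ≥ 0`. [folklore] -/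
theorem woodburyD1c_zero_nonneg : 0 ≤ woodburyD1c 0 := by
  have := mixedEc_nonneg 4 (le_refl (0 : ℝ)); unfold woodburyD1c; positivity

/-- `woodburyD2c 0 ≥ 0`. [folklore] -/
theorem woodburyD2c_zero_nonneg : 0 ≤ woodburyD2c 0 := by
  have := doubleEc_nonneg 4 (le_refl (0 : ℝ)); unfold woodburyD2c; exact this

/-- **the binder `hD` HOLDS**: `0 ≤ DE j`. [folklore] -/
theorem DE_nonneg : ∀ j, 0 ≤ DE j := by
  intro j
  match j with
  | 0 => exact woodburyDc_zero_nonneg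
  | 1 => exact woodburyD1c_zero_nonneg
  | 2 => exact woodburyD2c_zero_nonneg
  | (k + 3) =>
    show 0 ≤ 2 * woodburyD1c 0
    have := woodburyD1c_zero_nonneg; positivity

variable (a : ℝ) (ha : 0 < a) (SL : Finset L) (k : L → Fin 4)
include ha

/-- **the binder `h0S` HOLDS** for the instance (`MvE`, `X₀L`, diagonal components `k`, `re`,
`gE`, `DE`): (Γ0) at `N = n`, `m = 2(t+1)`, for every `t`. [folklore] -/
theorem h0S_E : ∀ n : ℕ, 2 ≤ n → ∀ b ∈ lblock SL n, ∀ v, ∀ᶠ t in atTop,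
    |GS MvE a (X₀L MvE) (fun _ b => k b.2) (fun _ b => k b.2) Complex.reAddGroupHom n b t v
        - gE a n b t v| ≤ DE 0 / (n : ℝ) ^ 2 := by
  intro n hn b _ v
  have h0 : 0 < n := by omega
  refine Eventually.of_forall fun t => ?_
  rw [GS_pos MvE a (X₀L MvE) _ _ _ h0, gE_pos a h0, DE_zero]
  exact gamma_row0 (PNat.val ⟨n, h0⟩) (evenPeriod t) (PNat.pos ⟨n, h0⟩) a ha _ _ v

/-- **the binder `h1S` HOLDS** for the instance: (Γ1) for every `t`. [folklore] -/
theorem h1S_E : ∀ n : ℕ, 2 ≤ n → ∀ b ∈ lblock SL n, ∀ v (ρ : Fin 4), ∀ᶠ t in atTop,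
    |(GS MvE a (X₀L MvE) (fun _ b => k b.2) (fun _ b => k b.2) Complex.reAddGroupHom n b t
          (v + BubbleTransfer.unitVec ρ) - gE a n b t (v + BubbleTransfer.unitVec ρ))
        - (GS MvE a (X₀L MvE) (fun _ b => k b.2) (fun _ b => k b.2) Complex.reAddGroupHom n b t v
          - gE a n b t v)| ≤ DE 1 / (n : ℝ) ^ 3 := by
  intro n hn b _ v ρ
  have h0 : 0 < n := by omega
  refine Eventually.of_forall fun t => ?_
  rw [GS_pos MvE a (X₀L MvE) _ _ _ h0, GS_pos MvE a (X₀L MvE) _ _ _ h0, gE_pos a h0, gE_pos a h0,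
    DE_one]
  exact gamma_row1 (PNat.val ⟨n, h0⟩) (evenPeriod t) (PNat.pos ⟨n, h0⟩) a ha _ _ v ρ

/-- **the binder `h1xS` HOLDS** for the instance: (Γ1×) for every `t`, the wrapped shift being a
translation by `e_μ` modulo block translations (`VectorTailsBlock.lwrapped_hX`). [folklore] -/
theorem h1xS_E (μ : Fin 4) : ∀ n : ℕ, 2 ≤ n → ∀ b ∈ lblock SL n, ∀ v, ∀ᶠ t in atTop,
    |GS MvE a (X₀L MvE) (fun _ b => k b.2) (fun _ b => k b.2) Complex.reAddGroupHom n
          (lshift n μ b) t v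
        - GS MvE a (X₀L MvE) (fun _ b => k b.2) (fun _ b => k b.2) Complex.reAddGroupHom n b t v|
      ≤ DE 3 / (n : ℝ) ^ 3 := by
  intro n hn b hb v
  have h0 : 0 < n := by omega
  refine Eventually.of_forall fun t => ?_
  rw [GS_pos MvE a (X₀L MvE) _ _ _ h0, GS_pos MvE a (X₀L MvE) _ _ _ h0, DE_three]
  exact gamma_row1x (PNat.val ⟨n, h0⟩) (evenPeriod t) (PNat.pos ⟨n, h0⟩) a ha
    (lwrapped_hX MvE SL μ ⟨n, h0⟩ t b hb) _ v

/-- **the binder `h2xS` HOLDS** for the instance: (Γ2×) for every `t`. [folklore] -/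
theorem h2xS_E (μ ν : Fin 4) : ∀ n : ℕ, 2 ≤ n → ∀ b ∈ lblock SL n, ∀ v, ∀ᶠ t in atTop,
    |(GS MvE a (X₀L MvE) (fun _ b => k b.2) (fun _ b => k b.2) Complex.reAddGroupHom n b t
            (v + BubbleTransfer.unitVec μ + BubbleTransfer.unitVec ν)
          - gE a n b t (v + BubbleTransfer.unitVec μ + BubbleTransfer.unitVec ν))
        - (GS MvE a (X₀L MvE) (fun _ b => k b.2) (fun _ b => k b.2) Complex.reAddGroupHom n b t
            (v + BubbleTransfer.unitVec μ) - gE a n b t (v + BubbleTransfer.unitVec μ))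
        - ((GS MvE a (X₀L MvE) (fun _ b => k b.2) (fun _ b => k b.2) Complex.reAddGroupHom n
              (lshift n μ b) t (v + BubbleTransfer.unitVec ν)
            - gE a n (lshift n μ b) t (v + BubbleTransfer.unitVec ν))
          - (GS MvE a (X₀L MvE) (fun _ b => k b.2) (fun _ b => k b.2) Complex.reAddGroupHom n
              (lshift n μ b) t v - gE a n (lshift n μ b) t v))| ≤ DE 2 / (n : ℝ) ^ 4 := by
  intro n hn b hb v
  have h0 : 0 < n := by omega
  refine Eventually.of_forall fun t => ?_
  simp only [GS_pos MvE a (X₀L MvE) _ _ _ h0, gE_pos a h0, DE_two]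
  exact gamma_row2x (PNat.val ⟨n, h0⟩) (evenPeriod t) (PNat.pos ⟨n, h0⟩) a ha
    (lwrapped_hX MvE SL μ ⟨n, h0⟩ t b hb) ν _ v

end Instance

/-! ## §4 The pointwise volume limits `hg` and `hG` -/

section Limits

variable {L : Type*}

/-- `G₀(−v) = gFree v` (both are `latticeGreen / 2`, and `latticeGreen` is even). [folklore] -/
theorem G₀_neg_eq_gFree (v : Pt) : G₀ (-v) = gFree v := by
  show Literature.Probability.LatticeModels.latticeGreen (-v) / 2
    = Literature.Probability.LatticeModels.latticeGreen v / 2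
  rw [Literature.Probability.LatticeModels.latticeGreen_neg]

/-- **the binder `hg` HOLDS**: the comparison leg tends to the `ℤ⁴` free leg, `gE → gFree v`
(`freeLeg_socket`).  Context: [Balaban1987RG1, p. 264] (the `t → ∞` limit at fixed scale).
[folklore] -/
theorem gE_tendsto (a : ℝ) (ha : 0 < a) {n : ℕ} (hn : 0 < n) (b : Pt × L) (v : Pt) :
    Tendsto (fun t => gE a n b t v) atTop (𝓝 (gFree v)) := by
  have hfun : (fun t => gE a n b t v)
      = fun t => torusFreeLeg (PNat.val ⟨n, hn⟩) (evenPeriod t) a (-v) :=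
    funext fun t => gE_pos a hn b t v
  rw [hfun, ← G₀_neg_eq_gFree]
  exact freeLeg_socket (PNat.val ⟨n, hn⟩) (by norm_num : 3 ≤ 4) (PNat.pos ⟨n, hn⟩) ha (-v)

/-- `hg` in the seam's binder shape. [folklore] -/
theorem hg_E (a : ℝ) (ha : 0 < a) (SL : Finset L) : ∀ n : ℕ, 2 ≤ n → ∀ b ∈ lblock SL n, ∀ v,
    Tendsto (fun t => gE a n b t v) atTop (𝓝 (gFree v)) :=
  fun _ hn b _ v => gE_tendsto a ha (by omega) b v

/-- the common block-translation vector `z_i = |p_i| + |v_i|` making both sites nonnegative.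
[folklore] -/
def zsh (p v : Pt) : Pt := fun i => |p i| + |v i|

/-- the `ℕ`-representative of the OBSERVATION site `p + v + n z`. [folklore] -/
def Xrep (n : ℕ) (p v : Pt) : Fin 4 → ℕ := fun i => (p i + v i + (n : ℤ) * zsh p v i).toNat

/-- the `ℕ`-representative of the SOURCE site `p + n z`. [folklore] -/
def Xrep' (n : ℕ) (p v : Pt) : Fin 4 → ℕ := fun i => (p i + (n : ℤ) * zsh p v i).toNat

/-- the observation site's representative is nonnegative (`n ≥ 1`). [folklore] -/
theorem Xrep_nonneg {n : ℕ} (hn : 1 ≤ n) (p v : Pt) (i : Fin 4) :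
    0 ≤ p i + v i + (n : ℤ) * zsh p v i := by
  have h1 : (1 : ℤ) ≤ n := by exact_mod_cast hn
  have hz : 0 ≤ zsh p v i := by unfold zsh; positivity
  have : zsh p v i ≤ (n : ℤ) * zsh p v i := le_mul_of_one_le_left hz h1
  unfold zsh at this ⊢
  nlinarith [le_abs_self (p i), le_abs_self (v i), neg_abs_le (p i), neg_abs_le (v i)]

/-- the source site's representative is nonnegative (`n ≥ 1`). [folklore] -/
theorem Xrep'_nonneg {n : ℕ} (hn : 1 ≤ n) (p v : Pt) (i : Fin 4) :
    0 ≤ p i + (n : ℤ) * zsh p v i := by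
  have h1 : (1 : ℤ) ≤ n := by exact_mod_cast hn
  have hz : 0 ≤ zsh p v i := by unfold zsh; positivity
  have : zsh p v i ≤ (n : ℤ) * zsh p v i := le_mul_of_one_le_left hz h1
  unfold zsh at this ⊢
  nlinarith [le_abs_self (p i), abs_nonneg (v i), neg_abs_le (p i)]

/-- the observation representative casts back to `p + v + n z`. [folklore] -/
theorem Xrep_cast {n : ℕ} (hn : 1 ≤ n) (p v : Pt) :
    (fun i => ((Xrep n p v i : ℕ) : ℤ)) = p + v + fun i => (n : ℤ) * zsh p v i := by
  funext i
  simp only [Xrep, Int.toNat_of_nonneg (Xrep_nonneg hn p v i), Pi.add_apply]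

/-- the source representative casts back to `p + n z`. [folklore] -/
theorem Xrep'_cast {n : ℕ} (hn : 1 ≤ n) (p v : Pt) :
    (fun i => ((Xrep' n p v i : ℕ) : ℤ)) = p + fun i => (n : ℤ) * zsh p v i := by
  funext i
  simp only [Xrep', Int.toNat_of_nonneg (Xrep'_nonneg hn p v i), Pi.add_apply]

variable (N m : ℕ) [NeZero N] [NeZero m] (hN : 1 ≤ N) (a : ℝ) (ha : 0 < a)

/-- **THE READING OF `𝒢` AT AN INTEGER BASE POINT IN THREE SOCKET-SHAPED TERMS** (per torus):
`rd(castT p; κ, κ; re; v) = torusFreeLeg N m a (−v) − N² Re R^⊥_w(emb X, emb X′) + N² Re 𝓛(emb X, κ; emb X′, κ)`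
with `X = Xrep N p v`, `X′ = Xrep' N p v` (block-translate the base point by `N z`,
`rd_translate`; split `rd = rdS + rdL`; §1). [folklore] -/
theorem rd_castT_eq_three (p v : Pt) (κ : Fin 4) :
    rd N hN (cubic 4 m) a ha (castT (fine N (cubic 4 m)) p) κ κ Complex.reAddGroupHom v
      = torusFreeLeg N m a (-v)
        - ((N : ℕ) : ℝ) ^ 2 *
          (RperpW N (cubic 4 m) (wB N m κ) a 0 (WoodburySymbol.emb N m (Xrep N p v))
            (WoodburySymbol.emb N m (Xrep' N p v))).re
        + ((N : ℕ) : ℝ) ^ 2 *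
          (Lker N hN (cubic 4 m) a ha (WoodburySymbol.emb N m (Xrep N p v)) κ
            (WoodburySymbol.emb N m (Xrep' N p v)) κ).re := by
  have hT := castT_blockVec_mem_blockSteps N (cubic 4 m) (zsh p v)
  rw [← rd_translate N hN (cubic 4 m) a ha hT (castT (fine N (cubic 4 m)) p) κ κ
    Complex.reAddGroupHom v, rd_eq_rdS_add_rdL, rdS_diag_eq, rdL_eq]
  have e1 : castT (fine N (cubic 4 m)) p + castT (fine N (cubic 4 m)) (fun μ => (N : ℤ) * zsh p v μ)
        + castT (fine N (cubic 4 m)) v = WoodburySymbol.emb N m (Xrep N p v) := by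
    rw [← castT_natCast_eq_emb, Xrep_cast hN, castT_add, castT_add, add_right_comm]
  have e2 : castT (fine N (cubic 4 m)) p + castT (fine N (cubic 4 m)) (fun μ => (N : ℤ) * zsh p v μ)
      = WoodburySymbol.emb N m (Xrep' N p v) := by
    rw [← castT_natCast_eq_emb, Xrep'_cast hN, castT_add]
  rw [e1, e2, re_apply]

/-- THE EXPLICIT VOLUME LIMIT of the instance's kernel family: at scale `n ≥ 1`, base point
`(p, ℓ)` and `v`,
`GfE a k n (p,ℓ) v = gFree v − n² Re RperpBLim n a 0 (k ℓ) X X′ + n² Re LkerLim n a X (k ℓ) X′ (k ℓ)`,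
`X = Xrep n p v`, `X′ = Xrep' n p v` (the `ℤ⁴` free leg, the Brillouin-zone bond-block Woodbury
symbol integral and the longitudinal symbol integral of an5); `0` at `n = 0`. [folklore] -/
def GfE (a : ℝ) (k : L → Fin 4) (n : ℕ) (b : Pt × L) (v : Pt) : ℝ :=
  if h : 0 < n then
    gFree v
      - ((n : ℕ) : ℝ) ^ 2 *
        (RperpBLim (PNat.val ⟨n, h⟩) a 0 (k b.2) (Xrep n b.1 v) (Xrep' n b.1 v)).re
      + ((n : ℕ) : ℝ) ^ 2 *
        (LkerLim (PNat.val ⟨n, h⟩) a (Xrep n b.1 v) (k b.2) (Xrep' n b.1 v) (k b.2)).re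
  else 0

/-- `GfE` at a positive scale. [folklore] -/
theorem GfE_pos (a : ℝ) (k : L → Fin 4) {n : ℕ} (h : 0 < n) (b : Pt × L) (v : Pt) :
    GfE a k n b v
      = gFree v
        - ((n : ℕ) : ℝ) ^ 2 *
          (RperpBLim (PNat.val ⟨n, h⟩) a 0 (k b.2) (Xrep n b.1 v) (Xrep' n b.1 v)).re
        + ((n : ℕ) : ℝ) ^ 2 *
          (LkerLim (PNat.val ⟨n, h⟩) a (Xrep n b.1 v) (k b.2) (Xrep' n b.1 v) (k b.2)).re :=
  dif_pos h

/-- two `ℕ`-representatives of the same `ℤ⁴` site that differ by block translations have a common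
upper block translate. [folklore] -/
theorem repr_common_shift {n : ℕ} (h : 0 < n) {X Y : Fin 4 → ℕ} {q w w' : Pt}
    (hX : (fun i => ((X i : ℕ) : ℤ)) = q + fun i => (n : ℤ) * w i)
    (hY : (fun i => ((Y i : ℕ) : ℤ)) = q + fun i => (n : ℤ) * w' i) :
    X + PNat.val ⟨n, h⟩ • (fun i => (w' i - w i).toNat)
      = Y + PNat.val ⟨n, h⟩ • (fun i => (w i - w' i).toNat) := by
  funext i
  have h1 := congrFun hX i
  have h2 := congrFun hY i
  simp only [Pi.add_apply] at h1 h2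
  have key : w i + ((w' i - w i).toNat : ℤ) = w' i + ((w i - w' i).toNat : ℤ) := by omega
  apply Nat.cast_injective (R := ℤ)
  simp only [Pi.add_apply, Pi.smul_apply, smul_eq_mul, PNat.mk_coe, Nat.cast_add, Nat.cast_mul,
    h1, h2]
  linear_combination (n : ℤ) * key

/-- **`GfE` DOES NOT DEPEND ON THE REPRESENTATIVES**: for ANY `X, X′ ∈ ℕ⁴` representing the
observation site `p + v` and the source site `p` up to a COMMON block translation `n w`
(`X = p + v + n w`, `X′ = p + n w`, `w ∈ ℤ⁴`), `GfE a k n (p,ℓ) v = gFree v − n² Re RperpBLim(k ℓ; X, X′)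
+ n² Re LkerLim(X, k ℓ; X′, k ℓ)` — by the block-translation invariance of the two limit kernels
(`BlockKernelVolumeSockets.RperpBLim_blockShift / LkerLim_blockShift`). [folklore] -/
theorem GfE_eq_of_repr (a : ℝ) (k : L → Fin 4) {n : ℕ} (h : 0 < n) (b : Pt × L) (v : Pt)
    {X X' : Fin 4 → ℕ} {w : Pt}
    (hX : (fun i => ((X i : ℕ) : ℤ)) = b.1 + v + fun i => (n : ℤ) * w i)
    (hX' : (fun i => ((X' i : ℕ) : ℤ)) = b.1 + fun i => (n : ℤ) * w i) :
    GfE a k n b v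
      = gFree v
        - ((n : ℕ) : ℝ) ^ 2 * (RperpBLim (PNat.val ⟨n, h⟩) a 0 (k b.2) X X').re
        + ((n : ℕ) : ℝ) ^ 2 * (LkerLim (PNat.val ⟨n, h⟩) a X (k b.2) X' (k b.2)).re := by
  have hXr : (fun i => ((Xrep n b.1 v i : ℕ) : ℤ)) = (b.1 + v) + fun i => (n : ℤ) * zsh b.1 v i :=
    Xrep_cast h b.1 v
  have hX2 : (fun i => ((X i : ℕ) : ℤ)) = (b.1 + v) + fun i => (n : ℤ) * w i := hX
  have e1 := repr_common_shift h hX2 hXr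
  have e2 := repr_common_shift h hX' (Xrep'_cast h b.1 v)
  rw [GfE_pos a k h,
    ← RperpBLim_blockShift (PNat.val ⟨n, h⟩) a 0 (k b.2) X X' (fun i => (zsh b.1 v i - w i).toNat),
    ← LkerLim_blockShift (PNat.val ⟨n, h⟩) a X (k b.2) X' (k b.2)
      (fun i => (zsh b.1 v i - w i).toNat),
    e1, e2, RperpBLim_blockShift, LkerLim_blockShift]

omit [NeZero N] [NeZero m] in
/-- **the binder `hG` HOLDS, pointwise**: at scale `n ≥ 1` the instance's kernel family tends, as
`t → ∞`, to the explicit `GfE` (free-leg socket + bond-block Woodbury socket + longitudinal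
socket of `Beta/BlockKernelVolumeSockets`).  Context: [Balaban1987RG1, p. 264]. [folklore] -/
theorem GT_tendsto_GfE (k : L → Fin 4) {n : ℕ} (h0 : 0 < n) (b : Pt × L) (v : Pt) :
    Tendsto (fun t => GT MvE a ha (X₀L MvE) (fun _ b => k b.2) (fun _ b => k b.2)
      Complex.reAddGroupHom n b t v) atTop (𝓝 (GfE a k n b v)) := by
  have hfun : (fun t => GT MvE a ha (X₀L MvE) (fun _ b => k b.2) (fun _ b => k b.2)
        Complex.reAddGroupHom n b t v)
      = fun t => torusFreeLeg (PNat.val ⟨n, h0⟩) (evenPeriod t) a (-v)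
          - ((n : ℕ) : ℝ) ^ 2 *
            (RperpW (PNat.val ⟨n, h0⟩) (cubic 4 (evenPeriod t))
              (wB (PNat.val ⟨n, h0⟩) (evenPeriod t) (k b.2)) a 0
              (WoodburySymbol.emb (PNat.val ⟨n, h0⟩) (evenPeriod t) (Xrep n b.1 v))
              (WoodburySymbol.emb (PNat.val ⟨n, h0⟩) (evenPeriod t) (Xrep' n b.1 v))).re
          + ((n : ℕ) : ℝ) ^ 2 *
            (Lker (PNat.val ⟨n, h0⟩) (PNat.pos ⟨n, h0⟩) (cubic 4 (evenPeriod t)) a ha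
              (WoodburySymbol.emb (PNat.val ⟨n, h0⟩) (evenPeriod t) (Xrep n b.1 v)) (k b.2)
              (WoodburySymbol.emb (PNat.val ⟨n, h0⟩) (evenPeriod t) (Xrep' n b.1 v)) (k b.2)).re := by
    funext t
    rw [GT_pos MvE a ha (X₀L MvE) _ _ _ h0]
    exact rd_castT_eq_three (PNat.val ⟨n, h0⟩) (evenPeriod t) (PNat.pos ⟨n, h0⟩) a ha b.1 v (k b.2)
  rw [hfun, GfE_pos a k h0, ← G₀_neg_eq_gFree]
  refine ((freeLeg_socket (PNat.val ⟨n, h0⟩) (by norm_num : 3 ≤ 4) (PNat.pos ⟨n, h0⟩) ha (-v)).sub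
    (Tendsto.const_mul _ ?_)).add (Tendsto.const_mul _ ?_)
  · exact RperpB_socket_re (PNat.val ⟨n, h0⟩) (by norm_num : 3 ≤ 4) (PNat.pos ⟨n, h0⟩) ha le_rfl
      (k b.2) (Xrep n b.1 v) (Xrep' n b.1 v)
  · exact Lker_socket_re (PNat.val ⟨n, h0⟩) (by norm_num : 0 < 4) (PNat.pos ⟨n, h0⟩) ha
      (Xrep n b.1 v) (k b.2) (Xrep' n b.1 v) (k b.2)

omit [NeZero N] [NeZero m] in
/-- `hG` in the seam's binder shape. [folklore] -/
theorem hG_E (SL : Finset L) (k : L → Fin 4) : ∀ n : ℕ, 2 ≤ n → ∀ b ∈ lblock SL n, ∀ v,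
    Tendsto (fun t => GT MvE a ha (X₀L MvE) (fun _ b => k b.2) (fun _ b => k b.2)
      Complex.reAddGroupHom n b t v) atTop (𝓝 (GfE a k n b v)) :=
  fun _ hn b _ v => GT_tendsto_GfE a ha k (by omega) b v

end Limits

/-! ## §5 END-TO-END in the even cubic volume -/

section EndToEnd

variable {L : Type*} (a : ℝ) (ha : 0 < a)

/-- **END-TO-END FOR THE VECTOR LEGS IN THE EVEN CUBIC VOLUME.**  The an1 seam
`VectorTailsSeam.endpointExistence_of_vectorTails_uniformBlock` for the family
`MvE (n,t) = cubic 4 (2(t+1))`, real reading, diagonal components `k`, with its six instance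
binders DISCHARGED here: `hgrow := hgrowE`, `hg := hg_E` (comparison leg `gE`), `hG := hG_E`
(explicit limit `GfE`), `h0S … h2xS := h0S_E … h2xS_E` (constants `DE`), `hD := DE_nonneg`.
WHAT REMAINS A BINDER, exactly: the printed Props `h12` / `h126` BY NAME for this family, and the
wall's one-loop data (hgen, S, hμν, hN, hL, hc/hM/hML, hU — about the explicit `GfE` —, hid, hγ₀,
hrem, hr, hβ', hcont, hup).  «END statement modulo {named binders}»; NOT `BetaPertH`, NOT the
continuum limit, NOT the Clay problem. [folklore] -/
theorem endpointExistence_of_vectorTails_evenVolume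
    (h12 : B5.Prop12Printed (fam (fun i : ℕ+ × ℕ => ((i.1 : ℕ+) : ℕ)) (fun i => i.1.pos) MvE a ha))
    (h126 : B5.Kernel126_127Printed (kfam (fun i : ℕ+ × ℕ => ((i.1 : ℕ+) : ℕ)) MvE))
    {SL : Finset L} (hSL : SL.Nonempty) (k : L → Fin 4)
    {μ ν : Fin 4}
    {β : HBeta} {Cn : B12.Construction} (hgen : ForwardGenerated Cn β)
    (S : B12Beta.OneLoopSplit β) (hμν : μ ≠ ν) {N : ℝ} (hN : N ≠ 0)
    {Lc : ℕ} (hL : 2 ≤ Lc) {μC : ℕ → ℕ → ℝ}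
    {U cc : ℝ} {M : ℕ → ℕ}
    (hc : 1 ≤ cc) (hM : ∀ L : ℕ, 2 ≤ L → 1 ≤ M L ∧ (L : ℝ) ≤ cc * M L) (hML : ∀ L : ℕ, 2 ≤ L → M L ≤ L)
    (hU : ∀ m : ℕ, 1 ≤ m →
      |composedCoeff μC m -
          ∑ b ∈ lblock SL (Lc ^ m), uwt SL (Lc ^ m) b * fullSum (stK μ ν N (GfE a k (Lc ^ m) b))| ≤ U)
    (hid : IdentityForm μC S.β0)
    {rr γ₀ β' : ℝ} (hγ₀ : 0 < γ₀) (hrem : RemainderConst S γ₀ rr) (hr : rr ≤ B12Normalization.stepBal N Lc)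
    (hβ' : 0 ≤ β') (hcont : BetaContH γ₀ β) (hup : BetaUpperH β' γ₀ β) : EndpointExistence Cn :=
  endpointExistence_of_vectorTails_uniformBlock MvE a ha h12 h126 (l := atTop) hgrowE hSL k k
    Complex.reAddGroupHom abs_re_le hgen S hμν hN hL DE_nonneg hc hM hML
    (hG_E a ha SL k) (hg_E a ha SL) (h0S_E a ha SL k) (h1S_E a ha SL k) (h1xS_E a ha SL k μ)
    (h2xS_E a ha SL k μ ν) hU hid hγ₀ hrem hr hβ' hcont hup

end EndToEnd

end Literature.MathematicalPhysics.QuantumFieldTheory.Balaban1983to89.Beta.VectorLegVolumeAdapter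

end
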